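import Mathlib
import Literature.Analysis.FluidPDE.VectorCalculus
import Literature.Analysis.FluidPDE.TaoAveragedNondegeneracy
import Summits.NavierStokesRegularity.NavierStokesRegularity.Theorems.FilamentSkeletonRssSkeletonEquilibriumGyrationFreeRigidity

/-!
# Rigidity of exactly gyration-free arcs of the self-similar binormal profile ODE — II: the arcs
(helper for the registered stub `stub_mirrorPointSelection` of crux `FilamentSkeletonRss.SkeletonEquilibrium`,
stmt-NavierStokesRegularity-15400, lines `mirror-point-negation` / `zero-accretion-selection`; continues
`…GyrationFreeRigidity`, whose notation is used: `A y = ½ y − α e₃ × y`, `B = A Yo`, `T = Yo′`, `n = ⟪B,B⟫`,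
`c' = ⟪T,B⟫`, `q = n T − c' B`, `F = (g n) q − c' · B × A T`)

Results (sorry-free):
* `hasDerivAt_drift`, `hasDerivAt_F` — chain rule: along `B′ = A T`, `T′ = g · T × B` the function
  `s ↦ F(B s, T s)` has derivative the explicit vector `F_dot` of `…GyrationFreeRigidity.certificate`;
* `locus_of_defect_eq_zero` — the stub's defect `Yo′ − c b − (c/g/‖B‖²) b × B_t` (`b = B/‖B‖`, `B_t = A Yo′`,
  `c = ⟪Yo′, b⟫`) vanishes at a point only if `B ≠ 0` and the point is on the locus `F = 0`;
* `gyrationFree_arc_on_axis` — **rigidity of exactly gyration-free arcs**: for a `C²` unit-speed solution of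
  `Yo″ = (4π/γ_k) • Yo′ × A Yo` (`γ_k ≠ 0`, `α ≠ 0`) whose defect vanishes identically on an open parameter set
  `I`, the solution lies on the rotation axis on `I` and its tangent is vertical there
  (`Yo s 0 = Yo s 1 = 0`, `Yo′ s × e₃ = 0`).
What this isolates for `stub_mirrorPointSelection` (which stays OPEN): for FIXED `(γ_k, α, θ)` the stub is
"rigidity + continuous dependence + compactness": by the slope-½ law (`…OuterSlopeHalf`) every solution visiting
`‖Yo‖ ≤ 2` has its waist datum in a compact set; a datum whose solution is not `θ`-vertical in that ball is not an
axis solution, so by `gyrationFree_arc_on_axis` (with `I = {s | Yo s ≠ 0}`) its defect is nonzero at some point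
off the origin, and continuity of the flow in the datum plus a finite subcover give uniform `(ε₀, R₁, R₃)`.
The remaining formal work is that continuous-dependence/compactness assembly (no numerics). No summit statement
is proved; NS regularity is not touched.
-/

noncomputable section

open Set Filter Topology
open Literature.Analysis.FluidPDE Literature.Analysis.FluidPDE.Tao2016
open scoped RealInnerProductSpace InnerProductSpace

namespace Summit.NavierStokesRegularity.NavierStokesRegularity.Theorems.SkeletonEquilibrium.MirrorPoint
set_option linter.dupNamespace false

/-! ## Chain rule: the flow derivative of `F` -/

/-- The drift `A Y = ½ Y − α e₃ × Y` along a differentiable curve has derivative `A Y′` (linearity, bundled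
through `crossCLM`). [folklore] -/
theorem hasDerivAt_drift {α : ℝ} {Y : ℝ → EuclideanSpace ℝ (Fin 3)}
    {T : EuclideanSpace ℝ (Fin 3)} {s : ℝ} (hY : HasDerivAt Y T s) :
    HasDerivAt
      (fun σ => (1 / 2 : ℝ) • Y σ - α • cross (EuclideanSpace.single (2 : Fin 3) (1 : ℝ)) (Y σ))
      ((1 / 2 : ℝ) • T - α • cross (EuclideanSpace.single (2 : Fin 3) (1 : ℝ)) T) s := by
  set L : EuclideanSpace ℝ (Fin 3) →L[ℝ] EuclideanSpace ℝ (Fin 3) :=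
    (1 / 2 : ℝ) • ContinuousLinearMap.id ℝ _ -
      α • crossCLM (EuclideanSpace.single (2 : Fin 3) (1 : ℝ)) with hL
  have hLapp : ∀ y, L y =
      (1 / 2 : ℝ) • y - α • cross (EuclideanSpace.single (2 : Fin 3) (1 : ℝ)) y :=
    fun y => by simp [hL, crossCLM_apply]
  have h := L.hasFDerivAt.comp_hasDerivAt s hY
  have hfun : (fun σ => (1 / 2 : ℝ) • Y σ -
      α • cross (EuclideanSpace.single (2 : Fin 3) (1 : ℝ)) (Y σ)) = L ∘ Y := by
    funext σ; simp [hLapp]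
  rw [hfun, ← hLapp]
  exact h

/-- **Chain rule for `F`.** Along any pair of curves with `B′ = A T`, `T′ = g · T × B` at `s` (the phase
flow of the profile ODE in the variables `B = A Yo`, `T = Yo′`), the function
`σ ↦ F(B σ, T σ) = (g ⟪B,B⟫) • (⟪B,B⟫ T − ⟪T,B⟫ B) − ⟪T,B⟫ • B × A T` has derivative the explicit
vector `F_dot(B s, T s)` of `certificate` (uses `⟪T × B, B⟫ = 0`, `⟪T, A T⟫ = ½‖T‖²`, `A T × A T = 0`).
[folklore] -/
theorem hasDerivAt_F {g α : ℝ} {B T : ℝ → EuclideanSpace ℝ (Fin 3)} {s : ℝ}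
    (hB : HasDerivAt B
      ((1 / 2 : ℝ) • T s - α • cross (EuclideanSpace.single (2 : Fin 3) (1 : ℝ)) (T s)) s)
    (hT : HasDerivAt T (g • cross (T s) (B s)) s) :
    HasDerivAt
      (fun σ => (g * ⟪B σ, B σ⟫) • (⟪B σ, B σ⟫ • T σ - ⟪T σ, B σ⟫ • B σ) -
        ⟪T σ, B σ⟫ • cross (B σ)
          ((1 / 2 : ℝ) • T σ - α • cross (EuclideanSpace.single (2 : Fin 3) (1 : ℝ)) (T σ)))
      ((2 * g * ⟪B s, (1 / 2 : ℝ) • T s - α • cross (EuclideanSpace.single (2 : Fin 3) (1 : ℝ)) (T s)⟫) •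
            (⟪B s, B s⟫ • T s - ⟪T s, B s⟫ • B s) +
          (g * ⟪B s, B s⟫) •
            ((2 * ⟪B s, (1 / 2 : ℝ) • T s - α • cross (EuclideanSpace.single (2 : Fin 3) (1 : ℝ)) (T s)⟫) •
                T s +
              (g * ⟪B s, B s⟫) • cross (T s) (B s) - (1 / 2 * ⟪T s, T s⟫) • B s -
              ⟪T s, B s⟫ •
                ((1 / 2 : ℝ) • T s - α • cross (EuclideanSpace.single (2 : Fin 3) (1 : ℝ)) (T s))) -
          (1 / 2 * ⟪T s, T s⟫) •
            cross (B s) ((1 / 2 : ℝ) • T s - α • cross (EuclideanSpace.single (2 : Fin 3) (1 : ℝ)) (T s)) -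
          (⟪T s, B s⟫ * g) •
            cross (B s) ((1 / 2 : ℝ) • cross (T s) (B s) -
              α • cross (EuclideanSpace.single (2 : Fin 3) (1 : ℝ)) (cross (T s) (B s))))
      s := by
  have hAT := hasDerivAt_drift (α := α) hT
  have hn := hB.inner ℝ hB
  have hc := hT.inner ℝ hB
  have hq := (hn.smul hT).sub (hc.smul hB)
  have h1 := (hn.const_mul g).smul hq
  have hcr : HasDerivAt (fun σ => cross (B σ)
      ((1 / 2 : ℝ) • T σ - α • cross (EuclideanSpace.single (2 : Fin 3) (1 : ℝ)) (T σ)))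
      (cross (B s) ((1 / 2 : ℝ) • (g • cross (T s) (B s)) -
          α • cross (EuclideanSpace.single (2 : Fin 3) (1 : ℝ)) (g • cross (T s) (B s))) +
        cross ((1 / 2 : ℝ) • T s - α • cross (EuclideanSpace.single (2 : Fin 3) (1 : ℝ)) (T s))
          ((1 / 2 : ℝ) • T s - α • cross (EuclideanSpace.single (2 : Fin 3) (1 : ℝ)) (T s))) s := by
    have := ContinuousLinearMap.hasDerivAt_of_bilinear (B := crossCLM) (fun _ => hB) (fun _ => hAT)
    simpa only [crossCLM_apply] using this
  have h2 := hc.smul hcr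
  refine (h1.sub h2).congr_deriv ?_
  simp only [real_inner_fin3, Pi.smul_apply', Pi.sub_apply]
  ext i
  fin_cases i <;>
  simp [cross_apply_zero, cross_apply_one, cross_apply_two, smul_eq_mul] <;> ring

/-! ## ODE corollary in the stub's notation -/

/-- From the stub's defect equation at a point: if `Yo′ − c b − (c/g/‖B‖²) b × B_t = 0` with `B = A Yo`,
`b = ‖B‖⁻¹ B`, `B_t = A Yo′`, `c = ⟪Yo′, b⟫`, `‖Yo′‖ = 1`, `g ≠ 0`, then `B ≠ 0` and the point is on the locus
`(g ⟪B,B⟫) • (⟪B,B⟫ T − ⟪T,B⟫ B) = ⟪T,B⟫ • B × A T` (`T = Yo′`; multiply by `g ‖B‖⁴`). [folklore] -/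
theorem locus_of_defect_eq_zero {g α : ℝ} (hg : g ≠ 0) {B T : EuclideanSpace ℝ (Fin 3)} (hT : ‖T‖ = 1)
    (hG : T - ⟪T, ‖B‖⁻¹ • B⟫ • (‖B‖⁻¹ • B) -
      (⟪T, ‖B‖⁻¹ • B⟫ / g / ‖B‖ ^ 2) •
        cross (‖B‖⁻¹ • B) ((1 / 2 : ℝ) • T - α • cross (EuclideanSpace.single (2 : Fin 3) (1 : ℝ)) T) = 0) :
    B ≠ 0 ∧
    (g * ⟪B, B⟫) • (⟪B, B⟫ • T - ⟪T, B⟫ • B) =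
      ⟪T, B⟫ • cross B ((1 / 2 : ℝ) • T - α • cross (EuclideanSpace.single (2 : Fin 3) (1 : ℝ)) T) := by
  have hB0 : B ≠ 0 := by
    intro h0
    rw [h0] at hG
    simp at hG
    have := hT
    rw [hG, norm_zero] at this
    exact zero_ne_one this
  refine ⟨hB0, ?_⟩
  have hr : ‖B‖ ≠ 0 := norm_ne_zero_iff.2 hB0
  rw [real_inner_smul_right, cross_smul_left, smul_smul, smul_smul] at hG
  have hn : ⟪B, B⟫ = ‖B‖ ^ 2 := real_inner_self_eq_norm_sq B
  have s1 : g * ‖B‖ ^ 4 * (‖B‖⁻¹ * ⟪T, B⟫ * ‖B‖⁻¹) = g * ‖B‖ ^ 2 * ⟪T, B⟫ := by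
    field_simp
  have s2 : g * ‖B‖ ^ 4 * (‖B‖⁻¹ * ⟪T, B⟫ / g / ‖B‖ ^ 2 * ‖B‖⁻¹) = ⟪T, B⟫ := by
    field_simp
  have key := congrArg (fun v => (g * ‖B‖ ^ 4) • v) hG
  simp only [smul_sub, smul_smul, smul_zero, s1, s2] at key
  rw [sub_eq_zero] at key
  rw [hn, smul_sub, smul_smul, smul_smul, show g * ‖B‖ ^ 2 * ‖B‖ ^ 2 = g * ‖B‖ ^ 4 by ring]
  exact key

/-- **Rigidity of exactly gyration-free arcs** (ODE corollary, stub notation). Let `Yo` be a `C²` unit-speed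
solution of `Yo″ = (4π/γ_k) • Yo′ × A Yo` (`A y = ½ y − α e₃ × y`, `γ_k ≠ 0`, `α ≠ 0`) whose first-order
gyration defect `Yo′ − c b − (c/(4π/γ_k)/‖B‖²) b × B_t` (`B = A Yo`, `b = B/‖B‖`, `B_t = A Yo′`,
`c = ⟪Yo′, b⟫` — the quantity bounded in `stub_mirrorPointSelection`) vanishes IDENTICALLY on an open parameter
set `I`. Then on `I` the solution lies on the rotation axis and its tangent is vertical:
`Yo s 0 = Yo s 1 = 0` and `Yo′ s × e₃ = 0`. (Differentiate `F ≡ 0` along the flow and apply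
`rigidity_algebra`; then the horizontal coordinates, constant on `I`, have zero derivative.) [folklore] -/
theorem gyrationFree_arc_on_axis {γk α : ℝ} (hγ : γk ≠ 0) (hα : α ≠ 0)
    {Yo : ℝ → EuclideanSpace ℝ (Fin 3)} (hYo : ContDiff ℝ 2 Yo) (hunit : ∀ s, ‖deriv Yo s‖ = 1)
    (hode : ∀ s, iteratedDeriv 2 Yo s = (4 * Real.pi / γk) • cross (deriv Yo s)
      ((1 / 2 : ℝ) • Yo s - α • cross (EuclideanSpace.single (2 : Fin 3) (1 : ℝ)) (Yo s)))
    {I : Set ℝ} (hI : IsOpen I)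
    (hG : ∀ s ∈ I, ∀ (B b Bt : EuclideanSpace ℝ (Fin 3)) (c : ℝ),
      B = (1 / 2 : ℝ) • Yo s - α • cross (EuclideanSpace.single (2 : Fin 3) (1 : ℝ)) (Yo s) →
      b = ‖B‖⁻¹ • B →
      Bt = (1 / 2 : ℝ) • deriv Yo s - α • cross (EuclideanSpace.single (2 : Fin 3) (1 : ℝ)) (deriv Yo s) →
      c = ⟪deriv Yo s, b⟫ →
      deriv Yo s - c • b - (c / (4 * Real.pi / γk) / ‖B‖ ^ 2) • cross b Bt = 0) :
    ∀ s ∈ I, Yo s 0 = 0 ∧ Yo s 1 = 0 ∧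
      cross (deriv Yo s) (EuclideanSpace.single (2 : Fin 3) (1 : ℝ)) = 0 := by
  set g : ℝ := 4 * Real.pi / γk with hg_def
  have hg : g ≠ 0 := div_ne_zero (by positivity) hγ
  -- derivative bookkeeping
  have hYd : ∀ σ, HasDerivAt Yo (deriv Yo σ) σ := fun σ =>
    ((hYo.differentiable (by norm_num)) σ).hasDerivAt
  have h2 : iteratedDeriv 2 Yo = deriv (deriv Yo) := by
    rw [iteratedDeriv_succ, iteratedDeriv_one]
  have hTd : ∀ σ, HasDerivAt (deriv Yo) (g • cross (deriv Yo σ)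
      ((1 / 2 : ℝ) • Yo σ - α • cross (EuclideanSpace.single (2 : Fin 3) (1 : ℝ)) (Yo σ))) σ := by
    intro σ
    have e : deriv (deriv Yo) σ = g • cross (deriv Yo σ)
        ((1 / 2 : ℝ) • Yo σ - α • cross (EuclideanSpace.single (2 : Fin 3) (1 : ℝ)) (Yo σ)) := by
      rw [← h2]; exact hode σ
    rw [← e]
    exact (hYo.differentiable_deriv_two σ).hasDerivAt
  have hBd : ∀ σ, HasDerivAt
      (fun σ => (1 / 2 : ℝ) • Yo σ - α • cross (EuclideanSpace.single (2 : Fin 3) (1 : ℝ)) (Yo σ))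
      ((1 / 2 : ℝ) • deriv Yo σ - α • cross (EuclideanSpace.single (2 : Fin 3) (1 : ℝ)) (deriv Yo σ)) σ :=
    fun σ => hasDerivAt_drift (hYd σ)
  -- (a) the locus equation `F = 0` on `I`
  have hF : ∀ σ ∈ I,
      (g * ⟪(1 / 2 : ℝ) • Yo σ - α • cross (EuclideanSpace.single (2 : Fin 3) (1 : ℝ)) (Yo σ),
          (1 / 2 : ℝ) • Yo σ - α • cross (EuclideanSpace.single (2 : Fin 3) (1 : ℝ)) (Yo σ)⟫) •
        (⟪(1 / 2 : ℝ) • Yo σ - α • cross (EuclideanSpace.single (2 : Fin 3) (1 : ℝ)) (Yo σ),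
            (1 / 2 : ℝ) • Yo σ - α • cross (EuclideanSpace.single (2 : Fin 3) (1 : ℝ)) (Yo σ)⟫ • deriv Yo σ -
          ⟪deriv Yo σ, (1 / 2 : ℝ) • Yo σ - α • cross (EuclideanSpace.single (2 : Fin 3) (1 : ℝ)) (Yo σ)⟫ •
            ((1 / 2 : ℝ) • Yo σ - α • cross (EuclideanSpace.single (2 : Fin 3) (1 : ℝ)) (Yo σ))) =
      ⟪deriv Yo σ, (1 / 2 : ℝ) • Yo σ - α • cross (EuclideanSpace.single (2 : Fin 3) (1 : ℝ)) (Yo σ)⟫ •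
        cross ((1 / 2 : ℝ) • Yo σ - α • cross (EuclideanSpace.single (2 : Fin 3) (1 : ℝ)) (Yo σ))
          ((1 / 2 : ℝ) • deriv Yo σ - α • cross (EuclideanSpace.single (2 : Fin 3) (1 : ℝ)) (deriv Yo σ)) := by
    intro σ hσ
    exact (locus_of_defect_eq_zero (α := α) hg (hunit σ) (hG σ hσ _ _ _ _ rfl rfl rfl rfl)).2
  -- (b) on-axis at every point of `I`
  have haxis : ∀ s ∈ I, Yo s 0 = 0 ∧ Yo s 1 = 0 := by
    intro s hs
    have hφ := hasDerivAt_F (g := g) (α := α) (hBd s) (hTd s)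
    have hφ0 : HasDerivAt (fun σ => (g * ⟪(1 / 2 : ℝ) • Yo σ - α • cross (EuclideanSpace.single (2 : Fin 3) (1 : ℝ)) (Yo σ),
          (1 / 2 : ℝ) • Yo σ - α • cross (EuclideanSpace.single (2 : Fin 3) (1 : ℝ)) (Yo σ)⟫) •
        (⟪(1 / 2 : ℝ) • Yo σ - α • cross (EuclideanSpace.single (2 : Fin 3) (1 : ℝ)) (Yo σ),
            (1 / 2 : ℝ) • Yo σ - α • cross (EuclideanSpace.single (2 : Fin 3) (1 : ℝ)) (Yo σ)⟫ • deriv Yo σ -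
          ⟪deriv Yo σ, (1 / 2 : ℝ) • Yo σ - α • cross (EuclideanSpace.single (2 : Fin 3) (1 : ℝ)) (Yo σ)⟫ •
            ((1 / 2 : ℝ) • Yo σ - α • cross (EuclideanSpace.single (2 : Fin 3) (1 : ℝ)) (Yo σ))) -
        ⟪deriv Yo σ, (1 / 2 : ℝ) • Yo σ - α • cross (EuclideanSpace.single (2 : Fin 3) (1 : ℝ)) (Yo σ)⟫ •
          cross ((1 / 2 : ℝ) • Yo σ - α • cross (EuclideanSpace.single (2 : Fin 3) (1 : ℝ)) (Yo σ))
            ((1 / 2 : ℝ) • deriv Yo σ - α • cross (EuclideanSpace.single (2 : Fin 3) (1 : ℝ)) (deriv Yo σ)))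
        (0 : EuclideanSpace ℝ (Fin 3)) s := by
      apply (hasDerivAt_const s (0 : EuclideanSpace ℝ (Fin 3))).congr_of_eventuallyEq
      filter_upwards [hI.mem_nhds hs] with σ hσ
      exact sub_eq_zero.2 (hF σ hσ)
    have hFdot0 := hφ.unique hφ0
    have hT0 : deriv Yo s ≠ 0 := fun h => by
      have := hunit s
      rw [h, norm_zero] at this
      exact zero_ne_one this
    have hZ := congrArg (fun v => ⟪v,
      ⟪(1 / 2 : ℝ) • Yo s - α • cross (EuclideanSpace.single (2 : Fin 3) (1 : ℝ)) (Yo s),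
          (1 / 2 : ℝ) • Yo s - α • cross (EuclideanSpace.single (2 : Fin 3) (1 : ℝ)) (Yo s)⟫ • deriv Yo s -
        ⟪deriv Yo s, (1 / 2 : ℝ) • Yo s - α • cross (EuclideanSpace.single (2 : Fin 3) (1 : ℝ)) (Yo s)⟫ •
          ((1 / 2 : ℝ) • Yo s - α • cross (EuclideanSpace.single (2 : Fin 3) (1 : ℝ)) (Yo s))⟫) hFdot0
    simp only [inner_zero_left] at hZ
    obtain ⟨h0, h1⟩ := rigidity_algebra hg hα hT0 (hF s hs) hZ
    rw [(drift_apply α (Yo s)).1] at h0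
    rw [(drift_apply α (Yo s)).2.1] at h1
    have e0 : (1 / 4 + α ^ 2) * Yo s 0 = 0 := by linear_combination (1 / 2 : ℝ) * h0 - α * h1
    have e1 : (1 / 4 + α ^ 2) * Yo s 1 = 0 := by linear_combination α * h0 + (1 / 2 : ℝ) * h1
    have hpos : (1 / 4 + α ^ 2 : ℝ) ≠ 0 := by positivity
    exact ⟨(mul_eq_zero.1 e0).resolve_left hpos, (mul_eq_zero.1 e1).resolve_left hpos⟩
  -- (c) vertical tangent: the horizontal coordinates are constant (zero) on the open set `I`
  intro s hs
  refine ⟨(haxis s hs).1, (haxis s hs).2, ?_⟩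
  have hcoord : ∀ i : Fin 3, (∀ σ ∈ I, Yo σ i = 0) → deriv Yo s i = 0 := by
    intro i hi
    have hd : HasDerivAt (fun σ => ⟪Yo σ, EuclideanSpace.single i (1 : ℝ)⟫)
        (⟪Yo s, (0 : EuclideanSpace ℝ (Fin 3))⟫ + ⟪deriv Yo s, EuclideanSpace.single i (1 : ℝ)⟫) s :=
      (hYd s).inner ℝ (hasDerivAt_const s _)
    have hd0 : HasDerivAt (fun σ => ⟪Yo σ, EuclideanSpace.single i (1 : ℝ)⟫) 0 s := by
      refine (hasDerivAt_const s (0 : ℝ)).congr_of_eventuallyEq ?_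
      filter_upwards [hI.mem_nhds hs] with σ hσ
      rw [EuclideanSpace.inner_single_right]
      simp [hi σ hσ]
    have := hd.unique hd0
    rw [inner_zero_right, zero_add, EuclideanSpace.inner_single_right] at this
    simpa using this
  have h0 := hcoord 0 (fun σ hσ => (haxis σ hσ).1)
  have h1 := hcoord 1 (fun σ hσ => (haxis σ hσ).2)
  ext i
  fin_cases i <;> simp [cross_apply_zero, cross_apply_one, cross_apply_two, h0, h1]


/-! ## Locus form (no division): for limits of solutions -/

/-- **Rigidity of arcs on the locus `F = 0` (division-free form).** Let `Yo` be a `C²` unit-speed solution of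
`Yo″ = g • Yo′ × A Yo` (`g ≠ 0`, `α ≠ 0`) such that on an open parameter set `I` the POLYNOMIAL locus equation
`(g n) • (n Yo′ − c' B) = c' • B × A Yo′` holds (`B = A Yo`, `n = ⟪B,B⟫`, `c' = ⟪Yo′,B⟫`; this is the stub's defect
equation cleared of denominators, cf. `locus_of_defect_eq_zero`, and — unlike the defect — is continuous in
`(Yo, Yo′)` everywhere, so it passes to limits of solutions). Then on `I` the solution lies on the rotation axis
with vertical tangent: `Yo s 0 = Yo s 1 = 0`, `Yo′ s × e₃ = 0`. [folklore] -/
theorem arc_on_axis_of_locus {g α : ℝ} (hg : g ≠ 0) (hα : α ≠ 0)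
    {Yo : ℝ → EuclideanSpace ℝ (Fin 3)} (hYo : ContDiff ℝ 2 Yo) (hunit : ∀ s, ‖deriv Yo s‖ = 1)
    (hode : ∀ s, iteratedDeriv 2 Yo s = g • cross (deriv Yo s)
      ((1 / 2 : ℝ) • Yo s - α • cross (EuclideanSpace.single (2 : Fin 3) (1 : ℝ)) (Yo s)))
    {I : Set ℝ} (hI : IsOpen I)
    (hF : ∀ σ ∈ I,
      (g * ⟪(1 / 2 : ℝ) • Yo σ - α • cross (EuclideanSpace.single (2 : Fin 3) (1 : ℝ)) (Yo σ),
          (1 / 2 : ℝ) • Yo σ - α • cross (EuclideanSpace.single (2 : Fin 3) (1 : ℝ)) (Yo σ)⟫) •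
        (⟪(1 / 2 : ℝ) • Yo σ - α • cross (EuclideanSpace.single (2 : Fin 3) (1 : ℝ)) (Yo σ),
            (1 / 2 : ℝ) • Yo σ - α • cross (EuclideanSpace.single (2 : Fin 3) (1 : ℝ)) (Yo σ)⟫ • deriv Yo σ -
          ⟪deriv Yo σ, (1 / 2 : ℝ) • Yo σ - α • cross (EuclideanSpace.single (2 : Fin 3) (1 : ℝ)) (Yo σ)⟫ •
            ((1 / 2 : ℝ) • Yo σ - α • cross (EuclideanSpace.single (2 : Fin 3) (1 : ℝ)) (Yo σ))) =
      ⟪deriv Yo σ, (1 / 2 : ℝ) • Yo σ - α • cross (EuclideanSpace.single (2 : Fin 3) (1 : ℝ)) (Yo σ)⟫ •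
        cross ((1 / 2 : ℝ) • Yo σ - α • cross (EuclideanSpace.single (2 : Fin 3) (1 : ℝ)) (Yo σ))
          ((1 / 2 : ℝ) • deriv Yo σ - α • cross (EuclideanSpace.single (2 : Fin 3) (1 : ℝ)) (deriv Yo σ))) :
    ∀ s ∈ I, Yo s 0 = 0 ∧ Yo s 1 = 0 ∧
      cross (deriv Yo s) (EuclideanSpace.single (2 : Fin 3) (1 : ℝ)) = 0 := by
  -- derivative bookkeeping
  have hYd : ∀ σ, HasDerivAt Yo (deriv Yo σ) σ := fun σ =>
    ((hYo.differentiable (by norm_num)) σ).hasDerivAt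
  have h2 : iteratedDeriv 2 Yo = deriv (deriv Yo) := by
    rw [iteratedDeriv_succ, iteratedDeriv_one]
  have hTd : ∀ σ, HasDerivAt (deriv Yo) (g • cross (deriv Yo σ)
      ((1 / 2 : ℝ) • Yo σ - α • cross (EuclideanSpace.single (2 : Fin 3) (1 : ℝ)) (Yo σ))) σ := by
    intro σ
    have e : deriv (deriv Yo) σ = g • cross (deriv Yo σ)
        ((1 / 2 : ℝ) • Yo σ - α • cross (EuclideanSpace.single (2 : Fin 3) (1 : ℝ)) (Yo σ)) := by
      rw [← h2]; exact hode σ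
    rw [← e]
    exact (hYo.differentiable_deriv_two σ).hasDerivAt
  have hBd : ∀ σ, HasDerivAt
      (fun σ => (1 / 2 : ℝ) • Yo σ - α • cross (EuclideanSpace.single (2 : Fin 3) (1 : ℝ)) (Yo σ))
      ((1 / 2 : ℝ) • deriv Yo σ - α • cross (EuclideanSpace.single (2 : Fin 3) (1 : ℝ)) (deriv Yo σ)) σ :=
    fun σ => hasDerivAt_drift (hYd σ)
  -- on-axis at every point of `I`
  have haxis : ∀ s ∈ I, Yo s 0 = 0 ∧ Yo s 1 = 0 := by
    intro s hs
    have hφ := hasDerivAt_F (g := g) (α := α) (hBd s) (hTd s)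
    have hφ0 : HasDerivAt (fun σ => (g * ⟪(1 / 2 : ℝ) • Yo σ - α • cross (EuclideanSpace.single (2 : Fin 3) (1 : ℝ)) (Yo σ),
          (1 / 2 : ℝ) • Yo σ - α • cross (EuclideanSpace.single (2 : Fin 3) (1 : ℝ)) (Yo σ)⟫) •
        (⟪(1 / 2 : ℝ) • Yo σ - α • cross (EuclideanSpace.single (2 : Fin 3) (1 : ℝ)) (Yo σ),
            (1 / 2 : ℝ) • Yo σ - α • cross (EuclideanSpace.single (2 : Fin 3) (1 : ℝ)) (Yo σ)⟫ • deriv Yo σ -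
          ⟪deriv Yo σ, (1 / 2 : ℝ) • Yo σ - α • cross (EuclideanSpace.single (2 : Fin 3) (1 : ℝ)) (Yo σ)⟫ •
            ((1 / 2 : ℝ) • Yo σ - α • cross (EuclideanSpace.single (2 : Fin 3) (1 : ℝ)) (Yo σ))) -
        ⟪deriv Yo σ, (1 / 2 : ℝ) • Yo σ - α • cross (EuclideanSpace.single (2 : Fin 3) (1 : ℝ)) (Yo σ)⟫ •
          cross ((1 / 2 : ℝ) • Yo σ - α • cross (EuclideanSpace.single (2 : Fin 3) (1 : ℝ)) (Yo σ))
            ((1 / 2 : ℝ) • deriv Yo σ - α • cross (EuclideanSpace.single (2 : Fin 3) (1 : ℝ)) (deriv Yo σ)))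
        (0 : EuclideanSpace ℝ (Fin 3)) s := by
      apply (hasDerivAt_const s (0 : EuclideanSpace ℝ (Fin 3))).congr_of_eventuallyEq
      filter_upwards [hI.mem_nhds hs] with σ hσ
      exact sub_eq_zero.2 (hF σ hσ)
    have hFdot0 := hφ.unique hφ0
    have hT0 : deriv Yo s ≠ 0 := fun h => by
      have := hunit s
      rw [h, norm_zero] at this
      exact zero_ne_one this
    have hZ := congrArg (fun v => ⟪v,
      ⟪(1 / 2 : ℝ) • Yo s - α • cross (EuclideanSpace.single (2 : Fin 3) (1 : ℝ)) (Yo s),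
          (1 / 2 : ℝ) • Yo s - α • cross (EuclideanSpace.single (2 : Fin 3) (1 : ℝ)) (Yo s)⟫ • deriv Yo s -
        ⟪deriv Yo s, (1 / 2 : ℝ) • Yo s - α • cross (EuclideanSpace.single (2 : Fin 3) (1 : ℝ)) (Yo s)⟫ •
          ((1 / 2 : ℝ) • Yo s - α • cross (EuclideanSpace.single (2 : Fin 3) (1 : ℝ)) (Yo s))⟫) hFdot0
    simp only [inner_zero_left] at hZ
    obtain ⟨h0, h1⟩ := rigidity_algebra hg hα hT0 (hF s hs) hZ
    rw [(drift_apply α (Yo s)).1] at h0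
    rw [(drift_apply α (Yo s)).2.1] at h1
    have e0 : (1 / 4 + α ^ 2) * Yo s 0 = 0 := by linear_combination (1 / 2 : ℝ) * h0 - α * h1
    have e1 : (1 / 4 + α ^ 2) * Yo s 1 = 0 := by linear_combination α * h0 + (1 / 2 : ℝ) * h1
    have hpos : (1 / 4 + α ^ 2 : ℝ) ≠ 0 := by positivity
    exact ⟨(mul_eq_zero.1 e0).resolve_left hpos, (mul_eq_zero.1 e1).resolve_left hpos⟩
  -- vertical tangent
  intro s hs
  refine ⟨(haxis s hs).1, (haxis s hs).2, ?_⟩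
  have hcoord : ∀ i : Fin 3, (∀ σ ∈ I, Yo σ i = 0) → deriv Yo s i = 0 := by
    intro i hi
    have hd : HasDerivAt (fun σ => ⟪Yo σ, EuclideanSpace.single i (1 : ℝ)⟫)
        (⟪Yo s, (0 : EuclideanSpace ℝ (Fin 3))⟫ + ⟪deriv Yo s, EuclideanSpace.single i (1 : ℝ)⟫) s :=
      (hYd s).inner ℝ (hasDerivAt_const s _)
    have hd0 : HasDerivAt (fun σ => ⟪Yo σ, EuclideanSpace.single i (1 : ℝ)⟫) 0 s := by
      refine (hasDerivAt_const s (0 : ℝ)).congr_of_eventuallyEq ?_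
      filter_upwards [hI.mem_nhds hs] with σ hσ
      rw [EuclideanSpace.inner_single_right]
      simp [hi σ hσ]
    have := hd.unique hd0
    rw [inner_zero_right, zero_add, EuclideanSpace.inner_single_right] at this
    simpa using this
  have h0 := hcoord 0 (fun σ hσ => (haxis σ hσ).1)
  have h1 := hcoord 1 (fun σ hσ => (haxis σ hσ).2)
  ext i
  fin_cases i <;> simp [cross_apply_zero, cross_apply_one, cross_apply_two, h0, h1]

end Summit.NavierStokesRegularity.NavierStokesRegularity.Theorems.SkeletonEquilibrium.MirrorPoint
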